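import Mathlib
import Literature.Probability.LatticeModels.GKSInequalities
import HarnessLib

/-!
# Crux `PrecisionLaplacian.InverseMFerromagnet` (stmt-CriticalPhenomena-4798), line `Sketch` —
# stub `helper_pencil_mixture` (core E infrastructure: the one-pair mixture identity of the pencil)

THEOREM-ONLY file (no definitions).  For a finite spin system `gksExpect univ K C` and two sites
`u ≠ v` write `κ = ∑_{i : C i = {u,v}} K i` for the total coupling carried by the bonds supported
exactly on the pair `{u,v}`, and `K⁰ i = if C i = {u,v} then 0 else K i` for the coupling vector
with those bonds switched off (the DELETED system of the deletion–contraction pencil).  Since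
`σ_{C i} = σ_u σ_v` when `C i = {u,v}` (`Finset.prod_pair`), the Hamiltonian splits as
`H_K = H_{K⁰} + κ σ_uσ_v`, i.e. `w_K = w_{K⁰} · e^{κ σ_uσ_v}` (`cpm_gksWeight_split`), and since
`σ_uσ_v = ±1`, `e^{κ σ_uσ_v} = cosh κ · (1 + tanh κ · σ_uσ_v)` (`cpm_exp_mul_pm`).  Hence every
unnormalised expectation is a two-term mixture of deleted ones,
`Z_K⟨g⟩_K = cosh κ · (Z⁰⟨g⟩⁰ + tanh κ · Z⁰⟨g σ_uσ_v⟩⁰)` (`cpm_gksSum_split`), and dividing the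
instances `g = f` and `g = 1` by `cosh κ · Z⁰ > 0` gives the registered identity
`⟨f⟩_K = (⟨f⟩⁰ + tanh κ ⟨f σ_uσ_v⟩⁰) / (1 + tanh κ ⟨σ_uσ_v⟩⁰)` (`helper_pencil_mixture`); no sign or
cardinality hypothesis on `K`, `C` is needed.
-/

namespace Summit.CriticalPhenomena.Ising3DConformalLimit.Cruxes.InverseMFerromagnet.PartialCovarianceLadder

open Literature.Probability.LatticeModels Finset Matrix

noncomputable section

/-- The Boltzmann weight with the `{u,v}`-bonds separated: `w_K(ω) = w_{K⁰}(ω) · e^{κ σ_uσ_v}` with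
`K⁰ i = if C i = {u,v} then 0 else K i` and `κ = ∑_{C i = {u,v}} K i`, because `σ_{C i} = σ_uσ_v`
for `C i = {u,v}`, `u ≠ v`. [folklore] -/
theorem cpm_gksWeight_split {n m : ℕ} (K : Fin m → ℝ) (C : Fin m → Finset (Fin n)) {u v : Fin n}
    (huv : u ≠ v) (ω : SpinConfig (Fin n)) :
    gksWeight Finset.univ K C ω
      = gksWeight Finset.univ (fun i => if C i = {u, v} then 0 else K i) C ω
        * Real.exp ((∑ i ∈ Finset.univ.filter (fun i => C i = {u, v}), K i)
            * (spinAt u ω * spinAt v ω)) := by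
  -- adapted from `db_gksWeight_old` (Theorems/PrecisionLaplacianInverseMFerromagnetDbOfIm)
  simp only [gksWeight, gksHamiltonian]
  rw [← Real.exp_add]
  congr 1
  rw [Finset.sum_mul, Finset.sum_filter, ← Finset.sum_add_distrib]
  refine Finset.sum_congr rfl fun i _ => ?_
  split_ifs with h
  · rw [h, spinProduct, Finset.prod_pair huv]; ring
  · ring

/-- `e^{κ s} = cosh κ · (1 + tanh κ · s)` for a sign `s = ±1` (`e^{±κ} = cosh κ ± sinh κ`,
`tanh = sinh / cosh`, `cosh > 0`). [folklore] -/
theorem cpm_exp_mul_pm (κ : ℝ) {s : ℝ} (hs : s = 1 ∨ s = -1) :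
    Real.exp (κ * s) = Real.cosh κ * (1 + Real.tanh κ * s) := by
  rw [exp_mul_eq_cosh_add_mul_sinh κ hs, Real.tanh_eq_sinh_div_cosh]
  have hc : Real.cosh κ ≠ 0 := (Real.cosh_pos κ).ne'
  field_simp

/-- `σ_u σ_v ∈ {1, -1}`. [folklore] -/
theorem cpm_pair_pm {n : ℕ} (u v : Fin n) (ω : SpinConfig (Fin n)) :
    spinAt u ω * spinAt v ω = 1 ∨ spinAt u ω * spinAt v ω = -1 := by
  rcases spinAt_eq_one_or_eq_neg_one u ω with hu | hu <;>
    rcases spinAt_eq_one_or_eq_neg_one v ω with hv | hv <;> rw [hu, hv] <;> norm_num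

/-- **The mixture identity, unnormalised.**  For every observable `g`,
`Z_K⟨g⟩_K = cosh κ · (Z⁰⟨g⟩⁰ + tanh κ · Z⁰⟨g σ_uσ_v⟩⁰)`, where `⁰` refers to the deleted couplings
`K⁰ i = if C i = {u,v} then 0 else K i` and `κ = ∑_{C i = {u,v}} K i`. [folklore] -/
theorem cpm_gksSum_split {n m : ℕ} (K : Fin m → ℝ) (C : Fin m → Finset (Fin n)) {u v : Fin n}
    (huv : u ≠ v) (g : SpinConfig (Fin n) → ℝ) :
    gksSum Finset.univ K C g
      = Real.cosh (∑ i ∈ Finset.univ.filter (fun i => C i = {u, v}), K i)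
        * (gksSum Finset.univ (fun i => if C i = {u, v} then 0 else K i) C g
          + Real.tanh (∑ i ∈ Finset.univ.filter (fun i => C i = {u, v}), K i)
            * gksSum Finset.univ (fun i => if C i = {u, v} then 0 else K i) C
                (fun ω => g ω * (spinAt u ω * spinAt v ω))) := by
  simp only [gksSum, Finset.mul_sum, mul_add]
  rw [← Finset.sum_add_distrib]
  refine Finset.sum_congr rfl fun ω _ => ?_
  rw [cpm_gksWeight_split K C huv ω, cpm_exp_mul_pm _ (cpm_pair_pm u v ω)]
  ring

/-- Pure algebra of the normalisation: `(A + tB)/(D + tF) = (A/D + t(B/D)) / (1 + t(F/D))` for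
`D ≠ 0` (no hypothesis on `D + tF`: both sides are `0` when it vanishes). [folklore] -/
theorem cpm_div_normalise (A B D F t : ℝ) (hD : D ≠ 0) :
    (A + t * B) / (D + t * F) = (A / D + t * (B / D)) / (1 + t * (F / D)) := by
  have h1 : A / D + t * (B / D) = (A + t * B) / D := by rw [add_div, mul_div_assoc]
  have h2 : 1 + t * (F / D) = (D + t * F) / D := by rw [add_div, div_self hD, mul_div_assoc]
  rw [h1, h2, div_div_div_cancel_right₀ hD]

/-- **Registered stub `helper_pencil_mixture` (core E infrastructure of line `Sketch`): the one-pair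
mixture identity.**  For two sites `u ≠ v`, total pair coupling `κ = ∑_{i : C i = {u,v}} K i` and
deleted couplings `K⁰ i = if C i = {u,v} then 0 else K i`, every expectation of the full system is
the tanh-mixture of deleted expectations
`⟨f⟩_K = (⟨f⟩_{K⁰} + tanh κ · ⟨f σ_uσ_v⟩_{K⁰}) / (1 + tanh κ · ⟨σ_uσ_v⟩_{K⁰})`:
`w_K = cosh κ · w_{K⁰} · (1 + tanh κ σ_uσ_v)` pointwise (`cpm_gksSum_split` with `g = f` and
`g = 1`), and numerator and denominator are divided by `cosh κ · Z_{K⁰} > 0`. [folklore] -/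
theorem helper_pencil_mixture :
    ∀ (n m : ℕ) (K : Fin m → ℝ) (C : Fin m → Finset (Fin n)) (u v : Fin n), u ≠ v →
      ∀ f : SpinConfig (Fin n) → ℝ,
        gksExpect Finset.univ K C f =
          (gksExpect Finset.univ (fun i => if C i = {u, v} then 0 else K i) C f +
              Real.tanh (∑ i ∈ Finset.univ.filter (fun i => C i = {u, v}), K i) *
                gksExpect Finset.univ (fun i => if C i = {u, v} then 0 else K i) C
                  (fun ω => f ω * (spinAt u ω * spinAt v ω))) /
            (1 + Real.tanh (∑ i ∈ Finset.univ.filter (fun i => C i = {u, v}), K i) *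
              gksExpect Finset.univ (fun i => if C i = {u, v} then 0 else K i) C
                (fun ω => spinAt u ω * spinAt v ω)) := by
  intro n m K C u v huv f
  have hc : Real.cosh (∑ i ∈ Finset.univ.filter (fun i => C i = {u, v}), K i) ≠ 0 :=
    (Real.cosh_pos _).ne'
  have hZ : gksSum Finset.univ (fun i => if C i = {u, v} then 0 else K i) C (fun _ => (1 : ℝ)) ≠ 0 :=
    (gksSum_one_pos _ _ _).ne'
  simp only [gksExpect]
  rw [cpm_gksSum_split K C huv f, cpm_gksSum_split K C huv (fun _ => 1), mul_div_mul_left _ _ hc]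
  simp only [one_mul]
  exact cpm_div_normalise _ _ _ _ _ hZ

end

end Summit.CriticalPhenomena.Ising3DConformalLimit.Cruxes.InverseMFerromagnet.PartialCovarianceLadder
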